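import Literature.Barriers.NavierStokesRegularity.ComplexNavierStokesBlowupSeriesEnergy
import HarnessLib

/-!
# Li–Sinai complex Navier–Stokes blow-up: exponential tilts and a tail-energy criterion

Fifth file of the barrier entry `ComplexNavierStokesBlowup` (D-0021), companion of
`ComplexNavierStokesBlowupSeries.lean` (the power series (3) of D. Li, Ya. G. Sinai, *Blow ups of
complex solutions of the 3D Navier–Stokes system and renormalization group method*, J. Eur. Math.
Soc. 10 (2008) 267–313, §2, PROVED there to solve the integral equation (1) at all times) and of
`ComplexNavierStokesBlowupSeriesEnergy.lean` (finite energy for small times, PROVED; the named fact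
`LiSinaiSeriesEnergyInfinite` = infinite energy of the series solution at one time for one
admissible datum, the unproved core, which implies the narrowed catalogue form
`LiSinaiCriticalEnergyBlowupNarrow`). Everything in this file is PROVED; no new fact is stated.
(Fourier space is written `EuclideanSpace ℝ (Fin 3)` throughout; `k 2` is the third coordinate
`k₃`.)

## What is here

* **Exponential tilts** (remark, ours). The integral equation (1),
  `v(k,t) = e^{-t|k|²} v(k,0) + ∫₀ᵗ e^{-(t-s)|k|²} ∫ ⟨v(k-k',s), k⟩ P_k v(k',s) dk' ds`
  [LiSinai2008, §1 eq. (1) p. 268], is covariant under `v(k,t) ↦ e^{⟨c,k⟩} v(k,t)` for every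
  fixed `c ∈ ℝ³`, because `e^{⟨c,k-k'⟩} e^{⟨c,k'⟩} = e^{⟨c,k⟩}` does not depend on the
  integration variable (on the physical side this is the translation `x ↦ x - ic` of the
  complex-valued velocity field). For the power series this is an identity of every mode:
  `LiSinai.mode_expTilt : mode (e^{⟨c,·⟩} v₀) p = e^{⟨c,k⟩} mode v₀ p`, hence
  `LiSinai.seriesSolution_expTilt`. The datum class of the core fact (measurable, bounded,
  vanishing off `{a ≤ k₃, |k| ≤ R}`, incompressible) is invariant under tilts.
* **Weighted-energy criterion** `LiSinaiSeriesEnergyInfinite.of_expTilt` (and `…_iff_expTilt`):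
  `LiSinaiSeriesEnergyInfinite` holds iff for some admissible datum `v₀`, some `t > 0` and some
  `c ∈ ℝ³` the WEIGHTED energy `∫ e^{2⟨c,k⟩} |seriesSolution v₀ t k|² dk` is infinite (the tilted
  datum `e^{⟨c,k⟩} v₀(k)` is admissible and its series solution has this energy at `t`); either
  gives `LiSinaiCriticalEnergyBlowupNarrow` (`LiSinaiCriticalEnergyBlowupNarrow.of_expTilt`).
* **Tail-energy criterion** `LiSinaiSeriesEnergyInfinite.of_tailEnergy` (and `…_iff_tailEnergy`):
  `LiSinaiSeriesEnergyInfinite` holds iff for some admissible datum, some `t > 0` and some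
  `L, θ > 0` the tail energies `T(n) = ∫_{k₃ ≥ nL} |seriesSolution v₀ t k|² dk` satisfy
  `T(n) ≥ θⁿ` for infinitely many `n` — i.e. iff the energy spread to large heights `k₃` by the
  cascade `supp g_p ⊆ C + ⋯ + C` [LiSinai2008, §2 p. 270] is NOT super-exponentially small in the
  height at one single time (backward: tilt by `c = μ e₃` with `e^{2μL} θ = 2`; forward: an
  infinite energy sits in every tail, because below any height the series is a finite sum of
  bounded compactly supported modes, `LiSinai.setLIntegral_seriesSolution_below_lt_top`). Hence
  also `LiSinaiCriticalEnergyBlowupNarrow.of_tailEnergy`.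

So the content of the source that the catalogue still lacks (Theorem 1, p. 311: the asymptotics
`g̃_p = p Z Λ^p e^{-|Y|²/2}(H⁽⁰⁾ + δ)`, proved there by a renormalisation-group construction with
computer-numerical steps, §7 p. 295 and p. 302, and used in §10 p. 312 at the critical amplitude
`A_cr = Λ(t)⁻¹`) can be replaced, for the purpose of the barrier, by ANY lower bound of geometric
type `θⁿ` on the tail energies of the explicit all-time solution `seriesSolution v₀ t` for one
admissible datum and one time. No such lower bound is proved here.

## References

* D. Li, Ya. G. Sinai, J. Eur. Math. Soc. 10 (2008) 267–313: §1 p. 268 (eq. (1)), §2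
  p. 269–270 (eqs. (3)–(6), `supp g_p`), §7 p. 295 and p. 302, Thm. 1 p. 311, §10 p. 312.
  [`LiSinai2008`]
-/

noncomputable section

open MeasureTheory Set Filter Topology Finset
open scoped ENNReal InnerProductSpace RealInnerProductSpace BigOperators

namespace Literature.Barriers.NavierStokesRegularity

namespace LiSinai

open Literature.Analysis.FluidPDE (leraySymbol leraySymbol_apply)

/-! ### Exponential tilts `v(k) ↦ e^{⟨c,k⟩} v(k)` -/

/-- The interaction integrand of (1) is covariant under a simultaneous exponential tilt of both
fields: `⟨e^{⟨c,k-k'⟩} F(k-k'), k⟩ P_k (e^{⟨c,k'⟩} G(k')) = e^{⟨c,k⟩} ⟨F(k-k'), k⟩ P_k G(k')`,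
since `e^{⟨c,k-k'⟩} e^{⟨c,k'⟩} = e^{⟨c,k⟩}`. [folklore] -/
theorem pairIntegrand_expTilt (c : EuclideanSpace ℝ (Fin 3))
    (F G : ℝ → EuclideanSpace ℝ (Fin 3) → EuclideanSpace ℝ (Fin 3)) (k : EuclideanSpace ℝ (Fin 3)) :
    pairIntegrand (fun s q => Real.exp ⟪c, q⟫ • F s q) (fun s q => Real.exp ⟪c, q⟫ • G s q) k =
      fun s k' => Real.exp ⟪c, k⟫ • pairIntegrand F G k s k' := by
  funext s k'
  have hexp : Real.exp ⟪c, k - k'⟫ * Real.exp ⟪c, k'⟫ = Real.exp ⟪c, k⟫ := by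
    rw [← Real.exp_add, inner_sub_right, sub_add_cancel]
  simp only [pairIntegrand, real_inner_smul_left, map_smul, smul_smul]
  congr 1
  rw [← hexp]
  ring

/-- The Duhamel pair is covariant under exponential tilts:
`duhamelPair (e^{⟨c,·⟩} F) (e^{⟨c,·⟩} G) t k = e^{⟨c,k⟩} duhamelPair F G t k` (no integrability
needed: `∫ a • f = a • ∫ f` unconditionally for a constant `a`). [folklore] -/
theorem duhamelPair_expTilt (c : EuclideanSpace ℝ (Fin 3))
    (F G : ℝ → EuclideanSpace ℝ (Fin 3) → EuclideanSpace ℝ (Fin 3)) (t : ℝ)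
    (k : EuclideanSpace ℝ (Fin 3)) :
    duhamelPair (fun s q => Real.exp ⟪c, q⟫ • F s q) (fun s q => Real.exp ⟪c, q⟫ • G s q) t k =
      Real.exp ⟪c, k⟫ • duhamelPair F G t k := by
  simp only [duhamelPair, pairIntegrand_expTilt, integral_smul, smul_comm _ (Real.exp ⟪c, k⟫),
    intervalIntegral.integral_smul]

/-- **Modes are covariant under exponential tilts of the datum**:
`mode (k ↦ e^{⟨c,k⟩} v₀(k)) p (t, k) = e^{⟨c,k⟩} mode v₀ p (t, k)` for every `p`, `t`, `k` — the
Fourier-side form of the invariance of the (complex) Navier–Stokes system under the complex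
translation `x ↦ x - ic`; induction on `p` over the recursion (4)–(6). [folklore] -/
theorem mode_expTilt (c : EuclideanSpace ℝ (Fin 3))
    (v₀ : EuclideanSpace ℝ (Fin 3) → EuclideanSpace ℝ (Fin 3)) :
    ∀ p, mode (fun k => Real.exp ⟪c, k⟫ • v₀ k) p =
      fun t k => Real.exp ⟪c, k⟫ • mode v₀ p t k := by
  intro p
  induction p using Nat.strong_induction_on with
  | _ p ih =>
  rcases p with _ | _ | m
  · funext t k; simp [mode_zero]
  · show mode (fun k => Real.exp ⟪c, k⟫ • v₀ k) 1 = fun t k => Real.exp ⟪c, k⟫ • mode v₀ 1 t k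
    funext t k; rw [mode_one, mode_one, smul_comm]
  · show mode (fun k => Real.exp ⟪c, k⟫ • v₀ k) (m + 2) =
      fun t k => Real.exp ⟪c, k⟫ • mode v₀ (m + 2) t k
    funext t k
    rw [mode_add_two, mode_add_two, Finset.smul_sum]
    refine Finset.sum_congr rfl fun i _ => ?_
    have hi2 := i.2
    rw [ih _ (by omega), ih _ (by omega), duhamelPair_expTilt]

/-- **The series solution is covariant under exponential tilts of the datum**:
`seriesSolution (k ↦ e^{⟨c,k⟩} v₀(k)) t k = e^{⟨c,k⟩} seriesSolution v₀ t k` (termwise, by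
`mode_expTilt`; no summability needed). [folklore] -/
theorem seriesSolution_expTilt (c : EuclideanSpace ℝ (Fin 3))
    (v₀ : EuclideanSpace ℝ (Fin 3) → EuclideanSpace ℝ (Fin 3)) (t : ℝ)
    (k : EuclideanSpace ℝ (Fin 3)) :
    seriesSolution (fun k => Real.exp ⟪c, k⟫ • v₀ k) t k =
      Real.exp ⟪c, k⟫ • seriesSolution v₀ t k := by
  unfold seriesSolution
  rw [← tsum_const_smul'']
  exact tsum_congr fun p => by rw [mode_expTilt]

/-- The squared extended norm of a tilted vector: `‖e^{x} v‖ₑ² = (ofReal e^{x})² ‖v‖ₑ²`.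
[folklore] -/
theorem enorm_exp_smul_sq (x : ℝ) (v : EuclideanSpace ℝ (Fin 3)) :
    ‖Real.exp x • v‖ₑ ^ 2 = ENNReal.ofReal (Real.exp x) ^ 2 * ‖v‖ₑ ^ 2 := by
  rw [enorm_smul, mul_pow, Real.enorm_eq_ofReal (Real.exp_pos x).le]

/-! ### Where an infinite energy can sit -/

/-- **The energy below any height is finite at every time.** For an admissible datum and
`t ≥ 0`, `∫_{k₃ < H} |seriesSolution v₀ t k|² dk < ∞`: below the height `H < N a` the series is
the sum of the `N` modes of order `< N` (`seriesSolution_eq_sum`), which are uniformly bounded on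
`[0, t]` (`mode_bound`) and vanish off the ball `|k| ≤ N |R|` (`mode_support`). So an infinite
energy at time `t` sits entirely in the tails `{k₃ ≥ H}`. [folklore] -/
theorem setLIntegral_seriesSolution_below_lt_top
    {v₀ : EuclideanSpace ℝ (Fin 3) → EuclideanSpace ℝ (Fin 3)} {a R M₀ : ℝ} (ha : 0 < a)
    (hv₀ : ∀ k, v₀ k ≠ 0 → a ≤ k 2 ∧ ‖k‖ ≤ R) (hM₀ : ∀ k, ‖v₀ k‖ ≤ M₀) {t : ℝ} (ht : 0 ≤ t)
    (H : ℝ) :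
    ∫⁻ k in {k : EuclideanSpace ℝ (Fin 3) | k 2 < H}, ‖seriesSolution v₀ t k‖ₑ ^ 2 < ∞ := by
  set N : ℕ := ⌊H / a⌋₊ + 1 with hN
  have hHN : H < (N : ℝ) * a := lt_floor_succ_mul ha H
  obtain ⟨M, hM0, hb⟩ := mode_bound hv₀ hM₀ t N
  have hmeas : MeasurableSet {k : EuclideanSpace ℝ (Fin 3) | k 2 < H} :=
    measurableSet_lt (by fun_prop) measurable_const
  set B : Set (EuclideanSpace ℝ (Fin 3)) := Metric.closedBall 0 (N * |R|) with hB
  -- pointwise domination by a constant on the ball `B`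
  have hpt : ∀ k ∈ {k : EuclideanSpace ℝ (Fin 3) | k 2 < H}, ‖seriesSolution v₀ t k‖ₑ ^ 2 ≤
      B.indicator (fun _ => ENNReal.ofReal (((N : ℝ) * M) ^ 2)) k := by
    intro k hk
    have hkN : k 2 < (N : ℝ) * a := lt_trans hk hHN
    rw [seriesSolution_eq_sum ha hv₀ hkN t]
    by_cases hball : k ∈ B
    · rw [indicator_of_mem hball]
      have hsum : ‖∑ p ∈ range N, mode v₀ p t k‖ ≤ (N : ℝ) * M := by
        refine (norm_sum_le _ _).trans ?_
        calc ∑ p ∈ range N, ‖mode v₀ p t k‖ ≤ ∑ p ∈ range N, M :=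
              Finset.sum_le_sum fun p hp => hb p (mem_range.1 hp).le t ⟨ht, le_rfl⟩ k
          _ = (N : ℝ) * M := by simp
      rw [← enorm_norm, Real.enorm_eq_ofReal (norm_nonneg _),
        ← ENNReal.ofReal_pow (norm_nonneg _)]
      exact ENNReal.ofReal_le_ofReal (pow_le_pow_left₀ (norm_nonneg _) hsum 2)
    · rw [indicator_of_notMem hball]
      have hzero : ∑ p ∈ range N, mode v₀ p t k = 0 := by
        refine Finset.sum_eq_zero fun p hp => ?_
        by_contra hne
        refine hball (Metric.mem_closedBall.2 ?_)
        rw [dist_zero_right]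
        calc ‖k‖ ≤ (p : ℝ) * R := (mode_support hv₀ p t k hne).2
          _ ≤ (p : ℝ) * |R| := mul_le_mul_of_nonneg_left (le_abs_self R) (Nat.cast_nonneg p)
          _ ≤ (N : ℝ) * |R| :=
            mul_le_mul_of_nonneg_right (by exact_mod_cast (mem_range.1 hp).le) (abs_nonneg R)
      simp [hzero]
  calc ∫⁻ k in {k : EuclideanSpace ℝ (Fin 3) | k 2 < H}, ‖seriesSolution v₀ t k‖ₑ ^ 2
      ≤ ∫⁻ k in {k : EuclideanSpace ℝ (Fin 3) | k 2 < H},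
          B.indicator (fun _ => ENNReal.ofReal (((N : ℝ) * M) ^ 2)) k :=
        setLIntegral_mono' hmeas hpt
    _ ≤ ∫⁻ k, B.indicator (fun _ => ENNReal.ofReal (((N : ℝ) * M) ^ 2)) k :=
        setLIntegral_le_lintegral _ _
    _ = ENNReal.ofReal (((N : ℝ) * M) ^ 2) * volume B :=
        lintegral_indicator_const measurableSet_closedBall _
    _ < ∞ := ENNReal.mul_lt_top ENNReal.ofReal_lt_top measure_closedBall_lt_top

/-- **Infinite energy sits in every tail.** For an admissible datum and `t ≥ 0`, if the energy
of the series solution at `t` is infinite then so is every tail energy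
`∫_{k₃ ≥ H} |seriesSolution v₀ t k|² dk`. [folklore] -/
theorem setLIntegral_seriesSolution_tail_eq_top
    {v₀ : EuclideanSpace ℝ (Fin 3) → EuclideanSpace ℝ (Fin 3)} {a R M₀ : ℝ} (ha : 0 < a)
    (hv₀ : ∀ k, v₀ k ≠ 0 → a ≤ k 2 ∧ ‖k‖ ≤ R) (hM₀ : ∀ k, ‖v₀ k‖ ≤ M₀) {t : ℝ} (ht : 0 ≤ t)
    (hinf : ∫⁻ k, ‖seriesSolution v₀ t k‖ₑ ^ 2 = ∞) (H : ℝ) :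
    ∫⁻ k in {k : EuclideanSpace ℝ (Fin 3) | H ≤ k 2}, ‖seriesSolution v₀ t k‖ₑ ^ 2 = ∞ := by
  have hmeas : MeasurableSet {k : EuclideanSpace ℝ (Fin 3) | H ≤ k 2} :=
    measurableSet_le measurable_const (by fun_prop)
  have hsplit := lintegral_add_compl (μ := (volume : Measure (EuclideanSpace ℝ (Fin 3))))
    (fun k => ‖seriesSolution v₀ t k‖ₑ ^ 2) hmeas
  have hcompl : {k : EuclideanSpace ℝ (Fin 3) | H ≤ k 2}ᶜ =
      {k : EuclideanSpace ℝ (Fin 3) | k 2 < H} := by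
    ext k; simp [not_le]
  rw [hinf, hcompl] at hsplit
  exact (ENNReal.add_eq_top.1 hsplit).resolve_right
    (setLIntegral_seriesSolution_below_lt_top ha hv₀ hM₀ ht H).ne

end LiSinai

open LiSinai

/-! ### Criteria for the core fact `LiSinaiSeriesEnergyInfinite` -/

/-- **Weighted-energy criterion for the core fact.** If some admissible datum `v₀` (measurable,
bounded, vanishing off `{a ≤ k₃, |k| ≤ R}` with `a > 0`, incompressible) has, at some time
`t > 0` and for some `c ∈ ℝ³`, infinite WEIGHTED energy
`∫ |e^{⟨c,k⟩} seriesSolution v₀ t k|² dk = ∞`, then `LiSinaiSeriesEnergyInfinite` holds: the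
tilted datum `k ↦ e^{⟨c,k⟩} v₀(k)` is admissible (bound `e^{‖c‖ |R|} M`) and its series solution
is `e^{⟨c,k⟩} seriesSolution v₀ t k` (`LiSinai.seriesSolution_expTilt`). [folklore] -/
theorem LiSinaiSeriesEnergyInfinite.of_expTilt
    (h : ∃ (v₀ : EuclideanSpace ℝ (Fin 3) → EuclideanSpace ℝ (Fin 3)) (a R t : ℝ)
      (c : EuclideanSpace ℝ (Fin 3)), 0 < a ∧ 0 < t ∧
      Measurable v₀ ∧ (∃ M : ℝ, ∀ k, ‖v₀ k‖ ≤ M) ∧ (∀ k, v₀ k ≠ 0 → a ≤ k 2 ∧ ‖k‖ ≤ R) ∧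
      (∀ k, ⟪v₀ k, k⟫ = 0) ∧
      ∫⁻ k, ‖Real.exp ⟪c, k⟫ • seriesSolution v₀ t k‖ₑ ^ 2 = ∞) :
    LiSinaiSeriesEnergyInfinite := by
  obtain ⟨v₀, a, R, t, c, ha, ht, hm, ⟨M, hM⟩, hsupp, hdiv, hinf⟩ := h
  have hM0 : 0 ≤ M := (norm_nonneg _).trans (hM 0)
  refine ⟨fun k => Real.exp ⟪c, k⟫ • v₀ k, a, R, t, ha, ht, ?_,
    ⟨Real.exp (‖c‖ * |R|) * M, fun k => ?_⟩, fun k hk => ?_, fun k => ?_, ?_⟩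
  · exact (Real.continuous_exp.comp (continuous_const.inner continuous_id)).measurable.smul hm
  · by_cases hk : v₀ k = 0
    · simp only [hk, smul_zero, norm_zero]
      positivity
    · rw [norm_smul, Real.norm_eq_abs, abs_of_pos (Real.exp_pos _)]
      refine mul_le_mul (Real.exp_le_exp.2 ?_) (hM k) (norm_nonneg _) (Real.exp_pos _).le
      calc ⟪c, k⟫ ≤ ‖c‖ * ‖k‖ := real_inner_le_norm c k
        _ ≤ ‖c‖ * |R| :=
          mul_le_mul_of_nonneg_left (((hsupp k hk).2).trans (le_abs_self R)) (norm_nonneg c)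
  · exact hsupp k fun h0 => hk (by simp only [h0, smul_zero])
  · rw [real_inner_smul_left, hdiv, mul_zero]
  · simp_rw [seriesSolution_expTilt]
    exact hinf

/-- **Weighted-energy criterion for the narrowed catalogue form**: the hypothesis of
`LiSinaiSeriesEnergyInfinite.of_expTilt` already gives `LiSinaiCriticalEnergyBlowupNarrow`
(via `LiSinaiSeriesEnergyInfinite.criticalEnergyBlowupNarrow`). [folklore] -/
theorem LiSinaiCriticalEnergyBlowupNarrow.of_expTilt
    (h : ∃ (v₀ : EuclideanSpace ℝ (Fin 3) → EuclideanSpace ℝ (Fin 3)) (a R t : ℝ)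
      (c : EuclideanSpace ℝ (Fin 3)), 0 < a ∧ 0 < t ∧
      Measurable v₀ ∧ (∃ M : ℝ, ∀ k, ‖v₀ k‖ ≤ M) ∧ (∀ k, v₀ k ≠ 0 → a ≤ k 2 ∧ ‖k‖ ≤ R) ∧
      (∀ k, ⟪v₀ k, k⟫ = 0) ∧
      ∫⁻ k, ‖Real.exp ⟪c, k⟫ • seriesSolution v₀ t k‖ₑ ^ 2 = ∞) :
    LiSinaiCriticalEnergyBlowupNarrow :=
  (LiSinaiSeriesEnergyInfinite.of_expTilt h).criticalEnergyBlowupNarrow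

/-- `LiSinaiSeriesEnergyInfinite` holds iff some admissible datum has infinite
`e^{2⟨c,k⟩}`-weighted energy at some time `t > 0` for some `c ∈ ℝ³` (forward: `c = 0`;
backward: `LiSinaiSeriesEnergyInfinite.of_expTilt`). [folklore] -/
theorem LiSinaiSeriesEnergyInfinite_iff_expTilt :
    LiSinaiSeriesEnergyInfinite ↔
      ∃ (v₀ : EuclideanSpace ℝ (Fin 3) → EuclideanSpace ℝ (Fin 3)) (a R t : ℝ)
        (c : EuclideanSpace ℝ (Fin 3)), 0 < a ∧ 0 < t ∧
        Measurable v₀ ∧ (∃ M : ℝ, ∀ k, ‖v₀ k‖ ≤ M) ∧ (∀ k, v₀ k ≠ 0 → a ≤ k 2 ∧ ‖k‖ ≤ R) ∧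
        (∀ k, ⟪v₀ k, k⟫ = 0) ∧
        ∫⁻ k, ‖Real.exp ⟪c, k⟫ • seriesSolution v₀ t k‖ₑ ^ 2 = ∞ := by
  refine ⟨fun h => ?_, LiSinaiSeriesEnergyInfinite.of_expTilt⟩
  obtain ⟨v₀, a, R, t, ha, ht, hm, hM, hsupp, hdiv, hinf⟩ := h
  refine ⟨v₀, a, R, t, 0, ha, ht, hm, hM, hsupp, hdiv, ?_⟩
  simpa only [inner_zero_left, Real.exp_zero, one_smul] using hinf

/-- An extended real that is `≥ 2ⁿ` for infinitely many `n` is `∞`. [folklore] -/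
theorem ENNReal.eq_top_of_frequently_two_pow_le {W : ℝ≥0∞}
    (h : ∃ᶠ n : ℕ in atTop, (2 : ℝ≥0∞) ^ n ≤ W) : W = ∞ := by
  by_contra hW
  obtain ⟨n, hn⟩ := ENNReal.exists_nat_gt hW
  obtain ⟨m, hmn, hm⟩ := h.forall_exists_of_atTop n
  have h1 : (n : ℝ≥0∞) ≤ 2 ^ n := by exact_mod_cast Nat.lt_two_pow_self.le
  have h2 : (2 : ℝ≥0∞) ^ n ≤ 2 ^ m := pow_le_pow_right₀ (by norm_num) hmn
  exact lt_irrefl W (hn.trans_le (h1.trans (h2.trans hm)))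

/-- **Tail-energy criterion for the core fact.** If some admissible datum `v₀` has, at some time
`t > 0`, tail energies `T(n) = ∫_{k₃ ≥ nL} |seriesSolution v₀ t k|² dk ≥ θⁿ` for infinitely many
`n` (some `L, θ > 0`), i.e. the energy carried to height `k₃ ≥ nL` by the cascade is not
super-exponentially small in `n`, then `LiSinaiSeriesEnergyInfinite` holds: with
`θ' = min θ 1` and `μ = log(2/θ')/(2L) ≥ 0` the weight `e^{2μk₃}` is `≥ e^{2μnL}` on the `n`-th
tail, so the `μ e₃`-tilted energy is `≥ (e^{2μL} θ')ⁿ = 2ⁿ` for infinitely many `n`, and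
`LiSinaiSeriesEnergyInfinite.of_expTilt` applies. This replaces, for the purpose of the barrier,
the asymptotics of Theorem 1 of the source by any geometric lower bound on the tail energies of
the explicit series solution at one time. [folklore] -/
theorem LiSinaiSeriesEnergyInfinite.of_tailEnergy
    (h : ∃ (v₀ : EuclideanSpace ℝ (Fin 3) → EuclideanSpace ℝ (Fin 3)) (a R t L θ : ℝ),
      0 < a ∧ 0 < t ∧ 0 < L ∧ 0 < θ ∧
      Measurable v₀ ∧ (∃ M : ℝ, ∀ k, ‖v₀ k‖ ≤ M) ∧ (∀ k, v₀ k ≠ 0 → a ≤ k 2 ∧ ‖k‖ ≤ R) ∧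
      (∀ k, ⟪v₀ k, k⟫ = 0) ∧
      ∃ᶠ n : ℕ in atTop, ENNReal.ofReal (θ ^ n) ≤
        ∫⁻ k in {k : EuclideanSpace ℝ (Fin 3) | (n : ℝ) * L ≤ k 2},
          ‖seriesSolution v₀ t k‖ₑ ^ 2) :
    LiSinaiSeriesEnergyInfinite := by
  obtain ⟨v₀, a, R, t, L, θ, ha, ht, hL, hθ, hm, hM, hsupp, hdiv, hfreq⟩ := h
  -- normalise `θ ≤ 1` and choose the tilt strength `μ ≥ 0` with `e^{2μL} θ' = 2`
  set θ' : ℝ := min θ 1 with hθ'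
  have hθ'0 : 0 < θ' := lt_min hθ one_pos
  have hθ'θ : θ' ≤ θ := min_le_left _ _
  set μ : ℝ := Real.log (2 / θ') / (2 * L) with hμ
  have hlog : 0 ≤ Real.log (2 / θ') :=
    Real.log_nonneg (by rw [le_div_iff₀ hθ'0]; linarith [min_le_right θ 1])
  have hμ0 : 0 ≤ μ := div_nonneg hlog (by positivity)
  have hkey : Real.exp (2 * μ * L) * θ' = 2 := by
    have h1 : 2 * μ * L = Real.log (2 / θ') := by rw [hμ]; field_simp
    rw [h1, Real.exp_log (by positivity)]
    field_simp
  refine LiSinaiSeriesEnergyInfinite.of_expTilt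
    ⟨v₀, a, R, t, μ • EuclideanSpace.single (2 : Fin 3) (1 : ℝ), ha, ht, hm, hM, hsupp, hdiv, ?_⟩
  have hinner : ∀ k : EuclideanSpace ℝ (Fin 3),
      ⟪μ • EuclideanSpace.single (2 : Fin 3) (1 : ℝ), k⟫ = μ * k 2 := by
    intro k
    rw [real_inner_smul_left, EuclideanSpace.inner_single_left]
    simp
  simp_rw [hinner]
  refine ENNReal.eq_top_of_frequently_two_pow_le (hfreq.mono fun n hn => ?_)
  set T : Set (EuclideanSpace ℝ (Fin 3)) := {k | (n : ℝ) * L ≤ k 2} with hT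
  have hmeas : MeasurableSet T := measurableSet_le measurable_const (by fun_prop)
  -- on the `n`-th tail the weight is at least `e^{2μnL}`
  have hw : ∀ k ∈ T,
      ENNReal.ofReal (Real.exp (μ * (n * L))) ^ 2 * ‖seriesSolution v₀ t k‖ₑ ^ 2 ≤
        ‖Real.exp (μ * k 2) • seriesSolution v₀ t k‖ₑ ^ 2 := by
    intro k hk
    rw [enorm_exp_smul_sq]
    gcongr
    exact hk
  calc (2 : ℝ≥0∞) ^ n = ENNReal.ofReal ((Real.exp (2 * μ * L) * θ') ^ n) := by
        rw [hkey, ENNReal.ofReal_pow zero_le_two, ENNReal.ofReal_ofNat]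
    _ ≤ ENNReal.ofReal (Real.exp (μ * (n * L))) ^ 2 * ENNReal.ofReal (θ ^ n) := by
        rw [← ENNReal.ofReal_pow (Real.exp_pos _).le, ← ENNReal.ofReal_mul (by positivity),
          mul_pow]
        refine ENNReal.ofReal_le_ofReal (mul_le_mul ?_ ?_ (by positivity) (by positivity))
        · rw [← Real.exp_nat_mul, ← Real.exp_nat_mul]
          exact Real.exp_le_exp.2 (le_of_eq (by push_cast; ring))
        · exact pow_le_pow_left₀ hθ'0.le hθ'θ n
    _ ≤ ENNReal.ofReal (Real.exp (μ * (n * L))) ^ 2 * ∫⁻ k in T, ‖seriesSolution v₀ t k‖ₑ ^ 2 :=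
        mul_le_mul_right hn _
    _ = ∫⁻ k in T, ENNReal.ofReal (Real.exp (μ * (n * L))) ^ 2 * ‖seriesSolution v₀ t k‖ₑ ^ 2 := by
        rw [lintegral_const_mul' _ _ (ENNReal.pow_ne_top ENNReal.ofReal_ne_top)]
    _ ≤ ∫⁻ k in T, ‖Real.exp (μ * k 2) • seriesSolution v₀ t k‖ₑ ^ 2 := setLIntegral_mono' hmeas hw
    _ ≤ ∫⁻ k, ‖Real.exp (μ * k 2) • seriesSolution v₀ t k‖ₑ ^ 2 := setLIntegral_le_lintegral _ _

/-- **Tail-energy criterion for the narrowed catalogue form**: the hypothesis of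
`LiSinaiSeriesEnergyInfinite.of_tailEnergy` already gives `LiSinaiCriticalEnergyBlowupNarrow`.
[folklore] -/
theorem LiSinaiCriticalEnergyBlowupNarrow.of_tailEnergy
    (h : ∃ (v₀ : EuclideanSpace ℝ (Fin 3) → EuclideanSpace ℝ (Fin 3)) (a R t L θ : ℝ),
      0 < a ∧ 0 < t ∧ 0 < L ∧ 0 < θ ∧
      Measurable v₀ ∧ (∃ M : ℝ, ∀ k, ‖v₀ k‖ ≤ M) ∧ (∀ k, v₀ k ≠ 0 → a ≤ k 2 ∧ ‖k‖ ≤ R) ∧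
      (∀ k, ⟪v₀ k, k⟫ = 0) ∧
      ∃ᶠ n : ℕ in atTop, ENNReal.ofReal (θ ^ n) ≤
        ∫⁻ k in {k : EuclideanSpace ℝ (Fin 3) | (n : ℝ) * L ≤ k 2},
          ‖seriesSolution v₀ t k‖ₑ ^ 2) :
    LiSinaiCriticalEnergyBlowupNarrow :=
  (LiSinaiSeriesEnergyInfinite.of_tailEnergy h).criticalEnergyBlowupNarrow

/-- `LiSinaiSeriesEnergyInfinite` holds iff some admissible datum has, at some time `t > 0`, tail
energies `∫_{k₃ ≥ nL} |seriesSolution v₀ t k|² dk ≥ θⁿ` for infinitely many `n` (some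
`L, θ > 0`). Forward: an infinite energy at `t` sits in every tail
(`LiSinai.setLIntegral_seriesSolution_tail_eq_top`), so `L = θ = 1` and every `n` will do;
backward: `LiSinaiSeriesEnergyInfinite.of_tailEnergy`. Thus the unproved core of the barrier is
EXACTLY the failure, for one admissible datum at one time, of super-exponential decay in the
height `k₃` of the energy of the explicit all-time series solution. [folklore] -/
theorem LiSinaiSeriesEnergyInfinite_iff_tailEnergy :
    LiSinaiSeriesEnergyInfinite ↔
      ∃ (v₀ : EuclideanSpace ℝ (Fin 3) → EuclideanSpace ℝ (Fin 3)) (a R t L θ : ℝ),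
        0 < a ∧ 0 < t ∧ 0 < L ∧ 0 < θ ∧
        Measurable v₀ ∧ (∃ M : ℝ, ∀ k, ‖v₀ k‖ ≤ M) ∧ (∀ k, v₀ k ≠ 0 → a ≤ k 2 ∧ ‖k‖ ≤ R) ∧
        (∀ k, ⟪v₀ k, k⟫ = 0) ∧
        ∃ᶠ n : ℕ in atTop, ENNReal.ofReal (θ ^ n) ≤
          ∫⁻ k in {k : EuclideanSpace ℝ (Fin 3) | (n : ℝ) * L ≤ k 2},
            ‖seriesSolution v₀ t k‖ₑ ^ 2 := by
  refine ⟨fun h => ?_, LiSinaiSeriesEnergyInfinite.of_tailEnergy⟩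
  obtain ⟨v₀, a, R, t, ha, ht, hm, ⟨M₀, hM₀⟩, hsupp, hdiv, hinf⟩ := h
  refine ⟨v₀, a, R, t, 1, 1, ha, ht, one_pos, one_pos, hm, ⟨M₀, hM₀⟩, hsupp, hdiv,
    Frequently.of_forall fun n => ?_⟩
  rw [setLIntegral_seriesSolution_tail_eq_top ha hsupp hM₀ ht.le hinf ((n : ℝ) * 1)]
  exact le_top

end Literature.Barriers.NavierStokesRegularity
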